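/- Copyright: the b2b-balaban cell (near-miss cell 7), T⁴-continuum fan-out; row NE7b ROUND-2 swarm, seat
t4-ne7b-formalise-leaf-01 (gen 9) (road W-RP, offer «W-2T» — journal INTENT l.17954; over W7 `HistoryChessboardGibbs`
p227659 of the owner's table `t4/b2b-balaban-t4-ne7b-p1/LEAVES-NE7b.md` v3.56; file 2).  Released under the licence of
the surrounding project. -/
import Summits.QuantumFields.BalabanUV.T4Continuum.Support.HistoryChessboardGibbsCells

/-!
# Road W-RP: THE TWO-TERM EVENT MODEL, file 2 — the cell-road witness, W7's Gibbs witness with two terms, the headline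

Summits-side support leaf of the T⁴-continuum cell (rung (B)+1 on a FINITE torus only; NOT infinite volume, NOT the
mass gap, NOT the Clay statement; NOT a proof of the spine estimate NE7b).  Row NE7b, road **W-RP** (R-OWNER-23-2 ∕
R-OWNER-23-8), offer «W-2T», file 2: the JUNCTION file 1 → W7 BY NAME.  [folklore] bookkeeping over TREE theorems;
ONE hypothesis shape (`CellRoadWitness`, `Type`-valued like W7's `ChessboardGibbsWitness`, consumed only under `Nonempty`
inside a binder) and one `def` (`toGibbsWitness`, the field-by-field junction); nothing printed asserted, no `[cite:]` tag,
no `Prop`-valued FACT minted (c1), no constant (c2∕c6), no exit ∕ socket ∕ `HistoryConstants` file touched (c3).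

WHAT.  §3 **`structure CellRoadWitness D g₀ os Λ m₁ : Type`** = W7's `ChessboardGibbsWitness` with the TERM layer removed:
cube side `hm₁`, `l₀`, `vol`, threshold `K₀`, patterns `P`, run A's cell events `E K l c` on the `K`-tower with per-cell
rate `r K`, run B's `E' K l c` on the `(K+1)`-tower with rate `r' K`, `cellA` ∕ `cellB : ∀ K ≥ K₀, CellSide …` (file 1:
the five cell-event clauses), `sum_r` ∕ `sum_r'`, the AGGREGATE small-field sandwich (file 1's `SmallFieldSandwich`) on the
weights `weight … K (twoEv P (E K)) t false` ∕ `weight … (K+1) (twoEv P (E' K)) t false` (W7 v1.1's `weight`) of the two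
runs' small-field terms, four summable NE7 rates — NO term family, NO bad class, NO shells, NO per-term constants.
**`CellRoadWitness.toGibbsWitness : ChessboardGibbsWitness D g₀ os Bool Λ m₁`**: `T := twoT K₀`, `A ∕ A' := weight …`,
`Bad := {true}`, `ev ∕ ev' := twoEv …`, `shA = shB = 0`, `Wsh = 0` (`shellWeightBound_zero_of_nonneg`), `budget :=
reindexedBudget_of_sandwich`, `sideA ∕ sideB := CellSide.gibbsCubeSide` — every other field copied.  §4 the ENDs over W7 BY
NAME (`SU(n)`, (0.4)-block-averaged data, measurable small-loop average): `stringHybridNE7_of_cellRoad`,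
`forSmallCouplings_gibbsWitness_of_cellRoad` (the prefixed hypothesis transport, `ι := Bool`),
`hybridNE7Under_of_cellRoad_fsc`, `targets_of_cellRoad_fsc`, **`continuumYM4Torus_of_cellRoad_fsc (hBA) (hE) (hB) (hβ)
(hData)`** — the two pins `(B) = B16.EndStatementBPrinted D.C` and `BetaPertHyp D.βfun` enter BY NAME inside W6's
`continuumYM4Torus_of_chessboardRoad_fsc` only (at `T4ContinuumYM4Torus.continuumYM4Torus_of_targets`).

CENSUS EFFECT (honest; the wording is the owner's ∕ typer's to fix; R-OWNER-23-8 wording for road W-RP: the printed,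
centred 4-d averaging prescription [B12] (0.3)–(0.4), (RP-ext) displayed as the covariance reading (γ)).  «Row NE7b, road
W-RP ON THE DATA'S OWN GIBBS CUBE TOWERS, TWO-TERM EVENT MODEL: kernel-complete BY NAME from the displayed readings to
`ContinuumYM4Torus D`: `ContinuumYM4Torus D ⇐ (B) ∧ BetaPertHyp ∧ [∀ small-coupling tuned run ∀ string: a CellRoadWitness]`,
and the witness DISPLAYS — as hypothesis shapes, none in print, none a theorem of the tree — per run and cutoff the FIVE
cell-event clauses (`E_meas`, (LOC) `loc`, (R-sym) `sym` — theorems for template ∕ column events by W3n ∕ W3o ∕ 4t ∕ W-LAB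
—, (U1)+(G2) `univ_le` with (B)'s lower half INSIDE as a reading, `r_nonneg`) and per cutoff the SIX inequalities of the
AGGREGATE two-run small-field sandwich (NE7's `ReindexedBudget` for the one small-field term, carrying through its rates
the content of NE1′–NE5 ∕ NE9), plus six summabilities; (EXT) `repr`, `bad_subset`, `ev_meas`, the partition, `bad_sub`,
NE7c's `ShellWeightBound` (zero shells) and the per-term layer of NE7's budget are DEFINITIONS ∕ THEOREMS on this road;
`prob`, the RP five, `Even`, `Z_pos`, `obs_*`, E1∕E2 theorems by name (W3 ∕ W4c ∕ W-E1 ∕ W7); the identifications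
«`blockAvg ℰ` is (0.4)» and «which cell events are Bałaban's large-field conditions» are READINGS (T-class).  NOTHING of
the nine discharged; spine count 0∕9 UNCHANGED; NE7b NOT proved; finite T⁴ only.»  HONEST DEPENDENCY (cell): continuum
YM on T⁴ ⇐ BetaPertH ∧ nine spine estimates (0/9 proved); BetaPertH ⇐ (D1) ∧ (D4) ∧ CAP+tail; G-an2-4 gates asym, D1 and
NE2/3/4.  This file changes none of it. -/

open Finset MeasureTheory
open Literature.Barriers.CriticalPhenomena.NonGibbs
open Literature.MathematicalPhysics.QuantumFieldTheory.Balaban1983to89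
open Literature.MathematicalPhysics.QuantumFieldTheory.Balaban1983to89.Missing
open Literature.MathematicalPhysics.QuantumFieldTheory.Balaban1983to89.T4Continuum
open Literature.MathematicalPhysics.QuantumFieldTheory.Balaban1983to89.T4IndicatorShell
open Literature.MathematicalPhysics.QuantumFieldTheory.Balaban1983to89.T4MatchingAssembly
open Literature.MathematicalPhysics.QuantumFieldTheory.Balaban1983to89.T4MatchingClosure
open Summit.QuantumFields.BalabanUV.T4Continuum
open HistoryRPTowerLaw HistoryChessboardEventsCubes HistoryChessboardTowerRepr HistoryChessboardApex
open HistoryChessboardHeadline HistoryChessboardGibbsSide HistoryChessboardGibbs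
open HistoryChessboardGibbsCells

namespace Summit.QuantumFields.BalabanUV.T4Continuum.HistoryChessboardGibbsCellsRoad

noncomputable section

/-! ## §3 The cell-road witness ⇒ W7's Gibbs witness with two terms -/

section Witness

variable {F : T4Family} {G : Type} [GaugeGroup G] [MeasurableSpace G] [HaarData G]

/-- **A CELL-ROAD WITNESS ON THE DATA'S OWN GIBBS CUBE TOWERS for the tuned run `g₀` and the loop string `os`**
(HYPOTHESIS SHAPE — data + displayed binders, NOTHING asserted): cubes of side `L^{m₁}` (`hm₁ : m₁ ≤ m`), source radius,
volume factor, threshold `K₀`, patterns `P`; per cutoff `K`, run A's cell events `E K l c` on the `K`-tower with per-cell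
rate `r K` and run B's `E' K l c` on the `(K+1)`-tower with rate `r' K`, each a `CellSide` from the threshold on;
summable rates; the AGGREGATE small-field sandwich on W7 v1.1's weights of the two runs' small-field terms `false` (the
events `(badEv P (E K))ᶜ` ∕ `(badEv P (E' K))ᶜ`); four summable NE7 rates.  NO term family, NO bad class, NO shells, NO
per-term constants: they are PRODUCED (`toGibbsWitness`). [folklore] -/
structure CellRoadWitness (D : FiniteEpsData F G) (g₀ : ℕ → ℝ) (os : List (ULoop F)) (Λ : Type) (m₁ : ℕ) : Type where
  /-- the cubes have side `L^{m₁}`, `m₁ ≤ m` -/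
  hm₁ : m₁ ≤ F.m
  /-- the source radius and the volume factor of the matching remainders, both positive -/
  (l₀ vol : ℝ) (l₀_pos : 0 < l₀) (vol_pos : 0 < vol)
  /-- the threshold in the number of steps -/
  K₀ : ℕ
  /-- the finite family of patterns (the shifted tilings) -/
  P : Finset Λ
  /-- run A: cell events of the patterns on the `K`-tower, per-cell rates -/
  (E : ∀ K, Λ → BlockIdx 4 (cubeCount F m₁) → Set (Tower (F.P K) G K)) (r : ℕ → ℝ)
  /-- run B: cell events of the patterns on the `(K+1)`-tower, per-cell rates -/
  (E' : ∀ K, Λ → BlockIdx 4 (cubeCount F m₁) → Set (Tower (F.P (K + 1)) G (K + 1))) (r' : ℕ → ℝ)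
  /-- run A's cell side from the threshold on -/
  cellA : ∀ K, K₀ ≤ K → CellSide D g₀ hm₁ K P (E K) (r K)
  /-- run B's cell side from the threshold on (the `(K+1)`-step run) -/
  cellB : ∀ K, K₀ ≤ K → CellSide D g₀ hm₁ (K + 1) P (E' K) (r' K)
  /-- the per-cell rates are summable over the cutoff -/
  (sum_r : Summable r) (sum_r' : Summable r')
  /-- the aggregate sandwich's constants and radii -/
  (Cc Rr CcRec RrRec : ℕ → ℝ → ℝ)
  /-- the NE7 rates; `rr u s s₂` summable -/
  (ν u s₂ c₀ rr s : ℕ → ℝ)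
  /-- NE7 in aggregate: the two-run sandwich on the weights of the small-field terms -/
  sandwich : SmallFieldSandwich l₀ vol K₀ (fun K t => weight D g₀ os K (twoEv P (E K)) t false)
    (fun K t => weight D g₀ os (K + 1) (twoEv P (E' K)) t false) Cc Rr CcRec RrRec ν u s₂ c₀ rr s
  /-- summable rates -/
  (sum_rr : Summable rr) (sum_u : Summable u) (sum_s : Summable s) (sum_s₂ : Summable s₂)

variable [RegularGaugeGroup G] {D : FiniteEpsData F G} {g₀ : ℕ → ℝ} {os : List (ULoop F)} {Λ : Type} {m₁ : ℕ}

/-- **THE JUNCTION: a cell-road witness IS W7's Gibbs witness with TWO TERMS** — `T := twoT K₀`, weights v1.1's `weight` of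
the two events, `Bad := {true}`, term events `twoEv`, zero shells (`shellWeightBound_zero_of_nonneg`),
NE7's budget from the sandwich (`reindexedBudget_of_sandwich`), sides from `CellSide.gibbsCubeSide`; every other field
copied. [folklore] -/
def CellRoadWitness.toGibbsWitness (X : CellRoadWitness D g₀ os Λ m₁) : ChessboardGibbsWitness D g₀ os Bool Λ m₁ where
  hm₁ := X.hm₁
  l₀ := X.l₀
  vol := X.vol
  l₀_pos := X.l₀_pos
  vol_pos := X.vol_pos
  K₀ := X.K₀
  P := X.P
  T := twoT X.K₀
  A K := weight D g₀ os K (twoEv X.P (X.E K))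
  A' K := weight D g₀ os (K + 1) (twoEv X.P (X.E' K))
  shA _ _ _ := 0
  shB _ _ _ := 0
  Bad _ := {true}
  ev K := twoEv X.P (X.E K)
  E := X.E
  r := X.r
  ev' K := twoEv X.P (X.E' K)
  E' := X.E'
  r' := X.r'
  sideA K hK := by
    rw [twoT_of_le hK]
    exact (X.cellA K hK).gibbsCubeSide os
  sideB K hK := by
    rw [twoT_of_le hK]
    exact (X.cellB K hK).gibbsCubeSide os
  sum_r := X.sum_r
  sum_r' := X.sum_r'
  Cc K t _ := X.Cc K t
  Rr K t _ := X.Rr K t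
  CcRec K t _ := X.CcRec K t
  RrRec K t _ := X.RrRec K t
  ν := X.ν
  u := X.u
  s₂ := X.s₂
  c₀ := X.c₀
  rr := X.rr
  s := X.s
  Wsh _ := 0
  shell := shellWeightBound_zero_of_nonneg (fun K t b _ => weight_nonneg D g₀ os K _ t b)
    (fun K t b _ => weight_nonneg D g₀ os (K + 1) _ t b)
  budget := reindexedBudget_of_sandwich (fun K t b => weight_nonneg D g₀ os K _ t b) X.sandwich
  sum_rr := X.sum_rr
  sum_u := X.sum_u
  sum_s := X.sum_s
  sum_s₂ := X.sum_s₂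

end Witness

/-! ## §4 The ENDs over W7, by name -/

section Ends

variable {F : T4Family} {n : ℕ} [NeZero n] {ℰ : LoopAverage (Matrix.specialUnitaryGroup (Fin n) ℂ)}

/-- **ONE STRING**: a cell-road witness ⇒ the apex lineage's per-string datum `StringHybridNE7 (D.scheme g₀) os l₀ vol K`,
some `K ≥ K₀` (W7's `stringHybridNE7_of_gibbsWitness` on `toGibbsWitness`).  CONDITIONAL; NE7b NOT proved. [folklore] -/
theorem stringHybridNE7_of_cellRoad {D : FiniteEpsData F (Matrix.specialUnitaryGroup (Fin n) ℂ)}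
    (hBA : D.IsBlockAveraged ℰ) (hE : ℰ.MeasurableE) {g₀ : ℕ → ℝ} {os : List (ULoop F)} {Λ : Type} {m₁ : ℕ}
    (X : CellRoadWitness D g₀ os Λ m₁) : ∃ K, X.K₀ ≤ K ∧ StringHybridNE7 (D.scheme g₀) os X.l₀ X.vol K :=
  stringHybridNE7_of_gibbsWitness hBA hE X.toGibbsWitness

/-- The prefixed cell-road hypothesis gives W7's prefixed Gibbs-witness hypothesis (`ForSmallCouplings.mono` with
`toGibbsWitness`, `ι := Bool`). [folklore] -/
theorem forSmallCouplings_gibbsWitness_of_cellRoad (D : FiniteEpsData F (Matrix.specialUnitaryGroup (Fin n) ℂ))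
    (hData : T4ContinuumYM4Torus.ForSmallCouplings D fun g₀ => ∀ os : List (ULoop F),
      ∃ (Λ : Type) (m₁ : ℕ), Nonempty (CellRoadWitness D g₀ os Λ m₁)) :
    T4ContinuumYM4Torus.ForSmallCouplings D fun g₀ => ∀ os : List (ULoop F),
      ∃ (ι Λ : Type) (_ : DecidableEq ι) (m₁ : ℕ), Nonempty (ChessboardGibbsWitness D g₀ os ι Λ m₁) :=
  hData.mono fun g₀ h os => by
    obtain ⟨Λ, m₁, ⟨X⟩⟩ := h os
    exact ⟨Bool, Λ, inferInstance, m₁, ⟨X.toGibbsWitness⟩⟩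

/-- **`HybridNE7Under D (BetaPertHyp D.βfun)` FROM THE PREFIXED CELL-ROAD WITNESSES** — the apex lineage's input for all
four T⁴ targets; the two antecedents accepted and not used (W7's `hybridNE7Under_of_gibbsWitness_fsc`).  CONDITIONAL; NE7b
NOT proved. [folklore] -/
theorem hybridNE7Under_of_cellRoad_fsc (D : FiniteEpsData F (Matrix.specialUnitaryGroup (Fin n) ℂ))
    (hBA : D.IsBlockAveraged ℰ) (hE : ℰ.MeasurableE)
    (hData : T4ContinuumYM4Torus.ForSmallCouplings D fun g₀ => ∀ os : List (ULoop F),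
      ∃ (Λ : Type) (m₁ : ℕ), Nonempty (CellRoadWitness D g₀ os Λ m₁)) :
    T4ApexHybrid.HybridNE7Under D (BetaPertHyp D.βfun) :=
  hybridNE7Under_of_gibbsWitness_fsc D hBA hE (forSmallCouplings_gibbsWitness_of_cellRoad D hData)

/-- **THE FOUR T⁴ TARGETS FROM THE CELL ROAD** (W7's `targets_of_gibbsWitness_fsc`): NO PIN IS AN INPUT (each target carries
its own prefix).  CONDITIONAL on the displayed prefixed witnesses; NE7b NOT proved. [folklore] -/
theorem targets_of_cellRoad_fsc (D : FiniteEpsData F (Matrix.specialUnitaryGroup (Fin n) ℂ))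
    (hBA : D.IsBlockAveraged ℰ) (hE : ℰ.MeasurableE)
    (hData : T4ContinuumYM4Torus.ForSmallCouplings D fun g₀ => ∀ os : List (ULoop F),
      ∃ (Λ : Type) (m₁ : ℕ), Nonempty (CellRoadWitness D g₀ os Λ m₁)) :
    D.ym4_torus_continuum_limit_exists ∧ D.ym4_torus_continuum_limit_unique ∧
      D.limit_reflectionPositive ∧ D.limit_torusCovariant :=
  targets_of_gibbsWitness_fsc D hBA hE (forSmallCouplings_gibbsWitness_of_cellRoad D hData)

/-- **THE HEADLINE PREDICATE FROM THE CELL ROAD ON THE DATA'S OWN GIBBS CUBE TOWERS**: `ContinuumYM4Torus D` for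
(0.4)-block-averaged `SU(n)` data with a measurable small-loop average, GIVEN the two pins `(B)` and `BetaPertHyp D.βfun` BY
NAME (consumed only inside W6's `continuumYM4Torus_of_chessboardRoad_fsc`, at `continuumYM4Torus_of_targets`) and, for all
small-coupling tuned runs and every loop string, a `CellRoadWitness`.  Honest reading: «road W-RP (the printed, centred 4-d
prescription [B12] (0.3)–(0.4)) on the data's own Gibbs cube towers, TWO-TERM event model: kernel-complete BY NAME from the
displayed FIVE cell-event clauses per run and cutoff ((LOC), (R-sym), (U1)+(G2) with (B)'s lower half inside as a reading)
+ the AGGREGATE small-field sandwich (NE7) + rates to `ContinuumYM4Torus D`; the term layer, NE7c and the per-term budget are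
bookkeeping here; nothing of the nine discharged; NE7b NOT proved; 0∕9; finite T⁴ only». [folklore] -/
theorem continuumYM4Torus_of_cellRoad_fsc (D : FiniteEpsData F (Matrix.specialUnitaryGroup (Fin n) ℂ))
    (hBA : D.IsBlockAveraged ℰ) (hE : ℰ.MeasurableE) (hB : B16.EndStatementBPrinted D.C) (hβ : BetaPertHyp D.βfun)
    (hData : T4ContinuumYM4Torus.ForSmallCouplings D fun g₀ => ∀ os : List (ULoop F),
      ∃ (Λ : Type) (m₁ : ℕ), Nonempty (CellRoadWitness D g₀ os Λ m₁)) :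
    T4ContinuumYM4Torus.ContinuumYM4Torus D :=
  continuumYM4Torus_of_gibbsWitness_fsc D hBA hE hB hβ (forSmallCouplings_gibbsWitness_of_cellRoad D hData)

end Ends

end

end Summit.QuantumFields.BalabanUV.T4Continuum.HistoryChessboardGibbsCellsRoad
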